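import Mathlib
import Summits.PneNP.PneNP.Theorems.CnfIdealGenLengthRankDefectRepresentationsTwoFamilyCutDomination
import Summits.PneNP.PneNP.Theorems.CnfIdealGenLengthRankDefectRepresentationsCutLemmaMaxCut

/-!
# Crux `RankDefectRepresentations` (stmt-PneNP-18923), line `rank-dehn-ladder`: AVERAGE MONOTONICITY for quadrant sub-instances
# (registered stub `stub_avgMonotone`, lead g16 RESHAPE 14, W17; memo `Cruxes/RankDefectRepresentations/Lines/rank-dehn-ladder-g16.md` §2(ii))

For a two-family instance `D` (rows/columns coloured by `{0,1}^n × {0,1}^{n'}`, double bipartition cut `doubleCut row col A A' D`)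
and a pair `(B, B')`, the QUADRANT SUB-INSTANCE keeps the entries whose row AND column have first-family colour in `B` and
second-family colour in `B'`.  Its internal double cuts `(S, S')`, `S ⊆ B`, `S' ⊆ B'`, averaged over the full cut space, are dominated
by the average double cut of `D`:
`2^(2^n − #B) · 2^(2^{n'} − #B') · Σ_{S ⊆ B, S' ⊆ B'} Φ_{D_q}(S, S') ≤ Σ_{A, A'} Φ_D(A, A')`.

Proof.  (1) POINTWISE: `Φ_{D_q}(A ∩ B, A' ∩ B') ≤ Φ_D(A, A')` for all `A, A'` — each of the two blocks defining `doubleCut` for the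
quadrant instance agrees with the corresponding block of `D` on quadrant rows × quadrant columns (there `cI ∈ A ∩ B ↔ cI ∈ A`, etc.) and
vanishes elsewhere, so it is obtained from `D`'s block by zeroing rows and columns (`rank_rowZero_le`, `rank_colZero_le`).
(2) COUNTING: `Σ_A g(A ∩ B) = 2^(card X − #B) · Σ_{S ⊆ B} g(S)` (the bijection `A ↦ (A ∩ B, A \ B)` onto `B.powerset ×ˢ Bᶜ.powerset`),
applied in both families.  (3) Sum (1) over all `(A, A')` and rewrite the left side by (2).
HONEST FRAMING: elementary negative-lane tool; the crux and the lead's stubs stay open; P ≠ NP is not moved; F-N2 is a FRONTIER formal rung.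
-/

set_option linter.dupNamespace false -- `Summit.PneNP.PneNP.…`: summit = sub-problem name (D-0017)

namespace Summit.PneNP.PneNP.Theorems.CnfIdealGenLengthRankDefectRepresentationsAvgMonotone

open Matrix Finset
open Summit.PneNP.PneNP.Theorems.CnfIdealGenLengthRankDefectRepresentationsTwoFamilyCutDomination (colourI colourJ maskJ doubleCut)
open Summit.PneNP.PneNP.Theorems.CnfIdealGenLengthRankDefectRepresentationsCutLemmaMaxCut (rank_rowZero_le rank_colZero_le)

variable {K : Type} [Field K]

/-! ## (1) A matrix living on a quadrant and agreeing there with `N` has rank at most `rank N` -/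

section Quadrant

variable {ι ι' : Type} [Fintype ι] [Fintype ι'] [DecidableEq ι] [DecidableEq ι']

/-- If `M` vanishes outside `P × Q` and agrees with `N` on `P × Q`, then `M` is `N` with rows and columns zeroed, so
`rank M ≤ rank N`. [folklore] -/
theorem rank_le_of_agree_on_quadrant (P : ι → Prop) (Q : ι' → Prop) [DecidablePred P] [DecidablePred Q] (M N : Matrix ι ι' K)
    (hin : ∀ x y, P x → Q y → M x y = N x y) (hout : ∀ x y, ¬ (P x ∧ Q y) → M x y = 0) : M.rank ≤ N.rank := by
  have e : M = Matrix.of fun x y => if P x then (Matrix.of fun x y => if Q y then N x y else 0) x y else 0 := by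
    ext x y
    by_cases hP : P x
    · by_cases hQ : Q y
      · simp only [Matrix.of_apply, if_pos hP, if_pos hQ]
        exact hin x y hP hQ
      · simp only [Matrix.of_apply, if_pos hP, if_neg hQ]
        exact hout x y (fun h => hQ h.2)
    · simp only [Matrix.of_apply, if_neg hP]
      exact hout x y (fun h => hP h.1)
  rw [e]
  exact (rank_rowZero_le P _).trans (rank_colZero_le Q N)

end Quadrant

/-! ## (1') Pointwise monotonicity of the double cut for quadrant sub-instances -/

section Pointwise

variable {n n' : ℕ} {ι ι' : Type} [Fintype ι] [Fintype ι'] [DecidableEq ι] [DecidableEq ι']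
variable (row : ι → Fin n ⊕ Fin n' → Bool) (col : ι' → Fin n ⊕ Fin n' → Bool)

/-- **Pointwise monotonicity.**  The double cut of the quadrant sub-instance of `(B, B')` at the internal cut `(A ∩ B, A' ∩ B')` is at
most the double cut of `D` at `(A, A')`. -/
theorem doubleCut_quadrant_inter_le (D : Matrix ι ι' K) (B A : Finset (Fin n → Bool)) (B' A' : Finset (Fin n' → Bool)) :
    doubleCut row col (A ∩ B) (A' ∩ B')
        (Matrix.of fun x y =>
          if colourI (row x) ∈ B ∧ colourJ (row x) ∈ B' ∧ colourI (col y) ∈ B ∧ colourJ (col y) ∈ B' then D x y else 0) ≤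
      doubleCut row col A A' D := by
  unfold doubleCut
  refine Nat.add_le_add ?_ ?_
  · refine rank_le_of_agree_on_quadrant (fun x => colourI (row x) ∈ B ∧ colourJ (row x) ∈ B')
      (fun y => colourI (col y) ∈ B ∧ colourJ (col y) ∈ B') _ _ ?_ ?_
    · rintro x y ⟨hxB, hxB'⟩ ⟨hyB, hyB'⟩
      simp [maskJ, hxB, hxB', hyB, hyB']
    · intro x y h
      have h4 : ¬ (colourI (row x) ∈ B ∧ colourJ (row x) ∈ B' ∧ colourI (col y) ∈ B ∧ colourJ (col y) ∈ B') :=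
        fun h' => h ⟨⟨h'.1, h'.2.1⟩, h'.2.2.1, h'.2.2.2⟩
      simp only [maskJ, Matrix.of_apply, if_neg h4, ite_self]
  · refine rank_le_of_agree_on_quadrant (fun x => colourI (row x) ∈ B ∧ colourJ (row x) ∈ B')
      (fun y => colourI (col y) ∈ B ∧ colourJ (col y) ∈ B') _ _ ?_ ?_
    · rintro x y ⟨hxB, hxB'⟩ ⟨hyB, hyB'⟩
      simp [maskJ, hxB, hxB', hyB, hyB']
    · intro x y h
      have h4 : ¬ (colourI (row x) ∈ B ∧ colourJ (row x) ∈ B' ∧ colourI (col y) ∈ B ∧ colourJ (col y) ∈ B') :=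
        fun h' => h ⟨⟨h'.1, h'.2.1⟩, h'.2.2.1, h'.2.2.2⟩
      simp only [maskJ, Matrix.of_apply, if_neg h4, ite_self]

end Pointwise

/-! ## (2) Counting: summing `g (A ∩ B)` over all `A` -/

section Counting

variable {X : Type} [Fintype X] [DecidableEq X]

/-- **Fibre count.**  `Σ_A g(A ∩ B) = 2^(card X − #B) · Σ_{S ⊆ B} g(S)`: the map `A ↦ (A ∩ B, A \ B)` is a bijection onto
`B.powerset ×ˢ Bᶜ.powerset`, and `#Bᶜ.powerset = 2^(card X − #B)`. [folklore] -/
theorem sum_inter_eq_pow_mul_sum_powerset (B : Finset X) (g : Finset X → ℕ) :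
    ∑ A : Finset X, g (A ∩ B) = 2 ^ (Fintype.card X - B.card) * ∑ S ∈ B.powerset, g S := by
  have h1 : ∑ A : Finset X, g (A ∩ B) = ∑ p ∈ B.powerset ×ˢ Bᶜ.powerset, g p.1 := by
    refine Finset.sum_nbij' (fun A => (A ∩ B, A \ B)) (fun p => p.1 ∪ p.2) ?_ ?_ ?_ ?_ ?_
    · intro A _
      simp only [Finset.mem_product, Finset.mem_powerset]
      exact ⟨Finset.inter_subset_right, fun x hx => Finset.mem_compl.mpr (Finset.mem_sdiff.mp hx).2⟩
    · intro p _
      exact Finset.mem_univ _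
    · intro A _
      ext x
      simp only [Finset.mem_union, Finset.mem_inter, Finset.mem_sdiff]
      tauto
    · intro p hp
      simp only [Finset.mem_product, Finset.mem_powerset] at hp
      obtain ⟨h1, h2⟩ := hp
      refine Prod.ext ?_ ?_
      · ext x
        simp only [Finset.mem_inter, Finset.mem_union]
        constructor
        · rintro ⟨hx | hx, hxB⟩
          · exact hx
          · exact absurd hxB (Finset.mem_compl.mp (h2 hx))
        · intro hx
          exact ⟨Or.inl hx, h1 hx⟩
      · ext x
        simp only [Finset.mem_sdiff, Finset.mem_union]
        constructor
        · rintro ⟨hx | hx, hxB⟩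
          · exact absurd (h1 hx) hxB
          · exact hx
        · intro hx
          exact ⟨Or.inr hx, Finset.mem_compl.mp (h2 hx)⟩
    · intro A _
      rfl
  rw [h1, Finset.sum_product]
  simp only [Finset.sum_const, smul_eq_mul, Finset.card_powerset, Finset.card_compl]
  rw [Finset.mul_sum]

/-- The two-family form of the fibre count, with `card (Fin n → Bool) = 2^n`. -/
theorem sum_sum_inter_eq {n n' : ℕ} (B : Finset (Fin n → Bool)) (B' : Finset (Fin n' → Bool))
    (Φ : Finset (Fin n → Bool) → Finset (Fin n' → Bool) → ℕ) :
    ∑ A : Finset (Fin n → Bool), ∑ A' : Finset (Fin n' → Bool), Φ (A ∩ B) (A' ∩ B') =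
      2 ^ (2 ^ n - B.card) * 2 ^ (2 ^ n' - B'.card) * ∑ S ∈ B.powerset, ∑ S' ∈ B'.powerset, Φ S S' := by
  have hX : Fintype.card (Fin n → Bool) = 2 ^ n := by simp
  have hX' : Fintype.card (Fin n' → Bool) = 2 ^ n' := by simp
  have step1 : ∀ A : Finset (Fin n → Bool),
      ∑ A' : Finset (Fin n' → Bool), Φ (A ∩ B) (A' ∩ B') = 2 ^ (2 ^ n' - B'.card) * ∑ S' ∈ B'.powerset, Φ (A ∩ B) S' := by
    intro A
    rw [sum_inter_eq_pow_mul_sum_powerset B' (fun S' => Φ (A ∩ B) S'), hX']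
  simp_rw [step1]
  rw [← Finset.mul_sum, sum_inter_eq_pow_mul_sum_powerset B (fun S => ∑ S' ∈ B'.powerset, Φ S S'), hX]
  ring

end Counting

/-! ## The registered stub -/

/-- **AVERAGE MONOTONICITY** (registered stub `stub_avgMonotone` of `Cruxes/RankDefectRepresentations/Lines/rank_dehn_ladder.lean`, lead g16
RESHAPE 14, W17): the quadrant `B × B'` sub-instance's double-cut sum over its internal cuts, scaled to the full cut space, is at most
`D`'s double-cut sum — `ē(quadrant) ≤ ē(D)`. -/
theorem stub_avgMonotone :
    ∀ (K : Type) [Field K] (n n' : ℕ) (ι ι' : Type) [Fintype ι] [Fintype ι'] [DecidableEq ι] [DecidableEq ι']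
      (row : ι → Fin n ⊕ Fin n' → Bool) (col : ι' → Fin n ⊕ Fin n' → Bool) (D : Matrix ι ι' K)
      (B : Finset (Fin n → Bool)) (B' : Finset (Fin n' → Bool)),
      2 ^ (2 ^ n - B.card) * 2 ^ (2 ^ n' - B'.card) *
          ∑ S ∈ B.powerset, ∑ S' ∈ B'.powerset,
            Summit.PneNP.PneNP.Theorems.CnfIdealGenLengthRankDefectRepresentationsTwoFamilyCutDomination.doubleCut row col S S'
              (Matrix.of fun x y =>
                if Summit.PneNP.PneNP.Theorems.CnfIdealGenLengthRankDefectRepresentationsTwoFamilyCutDomination.colourI (row x) ∈ B ∧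
                    Summit.PneNP.PneNP.Theorems.CnfIdealGenLengthRankDefectRepresentationsTwoFamilyCutDomination.colourJ (row x) ∈ B' ∧
                    Summit.PneNP.PneNP.Theorems.CnfIdealGenLengthRankDefectRepresentationsTwoFamilyCutDomination.colourI (col y) ∈ B ∧
                    Summit.PneNP.PneNP.Theorems.CnfIdealGenLengthRankDefectRepresentationsTwoFamilyCutDomination.colourJ (col y) ∈ B'
                then D x y else 0) ≤
        ∑ A : Finset (Fin n → Bool), ∑ A' : Finset (Fin n' → Bool),
          Summit.PneNP.PneNP.Theorems.CnfIdealGenLengthRankDefectRepresentationsTwoFamilyCutDomination.doubleCut row col A A' D := by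
  intro K _ n n' ι ι' _ _ _ _ row col D B B'
  calc 2 ^ (2 ^ n - B.card) * 2 ^ (2 ^ n' - B'.card) *
          ∑ S ∈ B.powerset, ∑ S' ∈ B'.powerset, doubleCut row col S S'
            (Matrix.of fun x y =>
              if colourI (row x) ∈ B ∧ colourJ (row x) ∈ B' ∧ colourI (col y) ∈ B ∧ colourJ (col y) ∈ B' then D x y else 0)
      = ∑ A : Finset (Fin n → Bool), ∑ A' : Finset (Fin n' → Bool), doubleCut row col (A ∩ B) (A' ∩ B')
            (Matrix.of fun x y =>
              if colourI (row x) ∈ B ∧ colourJ (row x) ∈ B' ∧ colourI (col y) ∈ B ∧ colourJ (col y) ∈ B' then D x y else 0) :=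
        (sum_sum_inter_eq B B' (fun S S' => doubleCut row col S S'
            (Matrix.of fun x y =>
              if colourI (row x) ∈ B ∧ colourJ (row x) ∈ B' ∧ colourI (col y) ∈ B ∧ colourJ (col y) ∈ B' then D x y else 0))).symm
    _ ≤ ∑ A : Finset (Fin n → Bool), ∑ A' : Finset (Fin n' → Bool), doubleCut row col A A' D :=
        Finset.sum_le_sum fun A _ => Finset.sum_le_sum fun A' _ => doubleCut_quadrant_inter_le row col D B A B' A'

end Summit.PneNP.PneNP.Theorems.CnfIdealGenLengthRankDefectRepresentationsAvgMonotone
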